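import Literature.NumberTheory.EllipticCurves.SteinWuthrich2013.PadicExpLogCoshProofs
import Literature.NumberTheory.EllipticCurves.SteinWuthrich2013.SplitUniformizationDataProofs
import Literature.NumberTheory.EllipticCurves.SteinWuthrich2013.MultiplicativeHeightExistenceProofs
import Literature.NumberTheory.EllipticCurves.SteinWuthrich2013.MultiplicativeHeightThetaOfUniformizationProofs
import Literature.NumberTheory.EllipticCurves.SteinWuthrich2013.TateSigmaThetaProofs
import Literature.NumberTheory.EllipticCurves.PAdicHeightsLogProofs
import HarnessLib

/-!
# Stein–Wuthrich 2013 §4.2: the canonical `p`-adic height at a split multiplicative prime exists,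
# given Silverman's theta difference relation on the Tate curve (proofs only)

Topic `Literature/NumberTheory/EllipticCurves` (cluster `SteinWuthrich2013`); proof file (theorems
only, nothing asserted, no definition). Cell `bsd-eis`, seat `bsd-eis-k5-c4` g3: ASSEMBLY of the
discharge of the named fact `exists_isSplitMultCanonical` (`MultiplicativeHeightExistence.lean`;
crux 4 `BSDpOnCellC` of route `EisensteinPrimes`, stmt-BirchSwinnertonDyer-19034,
`stub_publishedFacts` conjunct `hHs`) from ONE analytic identity on the Tate curve over `ℚ_p`:
Silverman's difference relation
`(X(u₁) − X(u₂)) θ(u₁)² θ(u₂)² = −u₂ θ(u₁u₂) θ(u₁u₂⁻¹)` for `u₁, u₂ ∈ ℚ_p^* ∖ q^ℤ`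
(ATAEC Prop. V.3.2 (b)(i), hypothesis `hV32` below; its `q`-expansion proof is the remaining input).

The chain (all steps are tree theorems):

* `exists_isSplitMultCanonical_of_theta_split` (`MultiplicativeHeightExistenceProofs.lean`): the
  height exists once `S(P) = C²σ_q(u(P))²` is non-zero on `E₁` and satisfies the theta
  (parallelogram) relation `S(P+Q)S(P−Q) = (x_Q − x_P)² S(P)² S(Q)²`;
* `tateSigma_input_of_uniformization` (`MultiplicativeHeightThetaOfUniformizationProofs.lean`):
  both follow from `hV32` and uniformisation data `(C, r, υ)` with
  `X(υ(P)) = C²x(P) + r`, `S`'s inner value `σ_q² ∘ cosh ∘ logUnitParamSq = θ(υ)²/υ`, `υ` multiplicative;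
* `exists_splitUniformizationData` (`SplitUniformizationDataProofs.lean`): the data over `ℚ_p` at a
  split multiplicative prime (`C_SW = u⁻¹` for the integral isomorphism `C • (W ⊗ ℚ_p) = E_q`);
* `padicFormalLog_param_eq_inv_u_mul_padicLog` (`SplitLogUniformizationProofs.lean`),
  `coshOfSq_padicLog_sq` (`PadicExpLogCoshProofs.lean`), `tateSigmaSq_cosh_eq`
  (`TateSigmaThetaProofs.lean`): `logUnitParamSq(P) = (log_p υ(P))²`,
  `cosh((log_p υ)²) = (υ+υ⁻¹)/2`, `σ_q²((υ+υ⁻¹)/2) = θ(υ)²/υ` — the value hypothesis `hυσ`.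

Main results:

* `norm_s_t_le_one_of_smul_eq_tateCurve` — for `p ≠ 2`, `C • (W ⊗ ℚ_p) = E_q` with `‖u‖ = 1`,
  `‖r‖ ≤ 1`, `W` `ℤ`-integral forces `‖s‖, ‖t‖ ≤ 1` (`2s = u − a₁`, `2t = −a₃ − r a₁`);
* `tateSigmaSq_coshOfSq_logUnitParamSq_eq` — **`σ_q²(cosh(logUnitParamSq(P))) = θ(υ(P))²/υ(P)`**;
* `tateSigma_input_of_thetaRelation` — the two inputs (`hS0`, `hΘ`) of
  `exists_isSplitMultCanonical_of_theta_split` at `(W, p ≠ 2, Dq)` from `hV32` at `Dq.q`;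
* `exists_isSplitMultCanonical_of_thetaRelation` — **`exists_isSplitMultCanonical` follows from
  Silverman's theta difference relation over `ℚ_p` (`p` odd)**.

## Sources

* W. Stein, C. Wuthrich, *Algorithms for the arithmetic of elliptic curves using Iwasawa theory*,
  Math. Comp. 82 (2013), §4.2 (pp. 15–16). [SteinWuthrich2013]
* J. H. Silverman, *Advanced Topics in the Arithmetic of Elliptic Curves* (1994), Thm. V.3.1,
  Prop. V.3.2 (b)(i) (PDF p. 399), §V.4, Thm. V.5.3. [SilvermanATAEC1994]
-/

noncomputable section

open scoped Classical

open WeierstrassCurve Literature.NumberTheory.EllipticCurves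
  Literature.NumberTheory.EllipticCurves.TateCurve Literature.NumberTheory.LocalFields

namespace Literature.NumberTheory.EllipticCurves.SteinWuthrich2013

variable {p : ℕ} [hp : Fact p.Prime] {W : WeierstrassCurve ℚ}

/-- For `p ≠ 2`: an isomorphism `C • (W ⊗ ℚ_p) = E_q` with `‖u‖ = 1`, `‖r‖ ≤ 1` from a
`ℤ`-integral `W` has `‖s‖ ≤ 1` and `‖t‖ ≤ 1` as well, because the Tate curve has `a₁ = 1`,
`a₃ = 0`, so `2s = u − a₁(W)` and `2t = −a₃(W) − r a₁(W)` (Silverman AEC III.1 Table 3.1), and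
`‖2‖_p = 1`. [Silverman ATAEC Thm. V.3.1 (a); AEC III Table 3.1]
[cite: SilvermanATAEC1994, Thm. V.3.1 (a) (PDF p. 395)] -/
theorem norm_s_t_le_one_of_smul_eq_tateCurve (hp2 : p ≠ 2) [W.IsIntegral ℤ] {q : ℚ_[p]}
    {C : VariableChange ℚ_[p]} (hC : C • W.baseChange ℚ_[p] = tateCurve q)
    (hu : ‖(C.u : ℚ_[p])‖ = 1) (hr : ‖C.r‖ ≤ 1) : ‖C.s‖ ≤ 1 ∧ ‖C.t‖ ≤ 1 := by
  set E : WeierstrassCurve ℚ_[p] := W.baseChange ℚ_[p] with hE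
  haveI : E.IsIntegral ℤ_[p] := by rw [hE]; infer_instance
  obtain ⟨ha₁, -, ha₃, -, -⟩ := E.norm_coeffs_le_one
  have h2 : ‖(2 : ℚ_[p])‖ = 1 := by
    have h := Padic.norm_natCast_eq_one_iff.mpr ((Nat.coprime_primes hp.out Nat.prime_two).mpr hp2)
    rwa [Nat.cast_ofNat] at h
  have e₁ : (C • E).a₁ = 1 := by rw [hC]; rfl
  have e₃ : (C • E).a₃ = 0 := by rw [hC]; rfl
  rw [variableChange_a₁] at e₁
  rw [variableChange_a₃] at e₃
  have hs2 : 2 * C.s = (C.u : ℚ_[p]) - E.a₁ := by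
    have h := congrArg (fun z => (C.u : ℚ_[p]) * z) e₁
    simp only [← mul_assoc, Units.mul_inv, one_mul, mul_one] at h
    linear_combination h
  have ht2 : 2 * C.t = -(E.a₃ + C.r * E.a₁) := by
    have h := (mul_eq_zero.mp e₃).resolve_left (pow_ne_zero 3 (C.u⁻¹).ne_zero)
    linear_combination h
  constructor
  · have hn : ‖2 * C.s‖ ≤ 1 := by
      rw [hs2, sub_eq_add_neg]
      refine (IsUltrametricDist.norm_add_le_max _ _).trans (max_le hu.le ?_)
      rw [norm_neg]; exact ha₁
    rwa [norm_mul, h2, one_mul] at hn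
  · have hn : ‖2 * C.t‖ ≤ 1 := by
      rw [ht2, norm_neg]
      refine (IsUltrametricDist.norm_add_le_max _ _).trans (max_le ha₃ ?_)
      rw [norm_mul]
      calc ‖C.r‖ * ‖E.a₁‖ ≤ 1 * 1 :=
            mul_le_mul hr ha₁ (norm_nonneg _) zero_le_one
        _ = 1 := one_mul _
    rwa [norm_mul, h2, one_mul] at hn

/-- **The value hypothesis `hυσ`: `σ_q²(cosh(logUnitParamSq W p q x y)) = θ(υ,q)²/υ`** for a
rational point `P = (x, y)` of `E₁(ℚ_p)` with one-unit Tate parameter `υ = υ(P) ≠ 1`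
(`(X(υ), Y(υ))` the image of `P` under the integral isomorphism `C • (W ⊗ ℚ_p) = E_q`, `‖u‖ = 1`,
`‖r‖, ‖s‖, ‖t‖ ≤ 1`, `uniformisationScaleSq = u⁻²`): `log_E(z(P)) = u⁻¹ log_p υ`
(`padicFormalLog_param_eq_inv_u_mul_padicLog`), so `logUnitParamSq(P) = (log_p υ)²`;
`cosh((log_p υ)²) = (υ + υ⁻¹)/2` (`coshOfSq_padicLog_sq`, `p ≠ 2`); and
`σ_q²((υ+υ⁻¹)/2) = θ(υ)²/υ` (`tateSigmaSq_cosh_eq`). This is SW's "`t(P) ↦ u(P) = exp_p log_p`,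
`σ_p(u) = (u−1)u^{−1/2}∏…`". [Stein–Wuthrich 2013, §4.2 (p. 15)]
[cite: SteinWuthrich2013, §4.2 (p. 15)] -/
theorem tateSigmaSq_coshOfSq_logUnitParamSq_eq (hp2 : p ≠ 2) [W.IsElliptic] [W.IsIntegral ℤ]
    {q : ℚ_[p]} (hq0 : q ≠ 0) (hq : ‖q‖ < 1) {C : VariableChange ℚ_[p]}
    (hC : C • W.baseChange ℚ_[p] = tateCurve q) (hu : ‖(C.u : ℚ_[p])‖ = 1) (hr : ‖C.r‖ ≤ 1)
    (hs : ‖C.s‖ ≤ 1) (ht : ‖C.t‖ ≤ 1)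
    (hscale : ((C.u : ℚ_[p])⁻¹) ^ 2 = uniformisationScaleSq W p q) {x y : ℚ} {υ : ℚ_[p]}
    (hυ1 : ‖υ - 1‖ < 1) (hυne : υ ≠ 1) (hX : tateX q υ = C.toX (x : ℚ_[p]))
    (hY : tateY q υ = C.toY (x : ℚ_[p]) (y : ℚ_[p])) :
    tateSigmaSq q (coshOfSq (logUnitParamSq W p q x y)) = tateTheta q υ ^ 2 / υ := by
  have hu0 : (C.u : ℚ_[p]) ≠ 0 := C.u.ne_zero
  have hυ1' : ‖υ - 1‖ ≤ (p : ℝ)⁻¹ := norm_le_inv_of_norm_lt_one hυ1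
  have hυn : ‖υ‖ = 1 := norm_eq_one_of_norm_sub_one_lt hυ1
  have hυ0 : υ ≠ 0 := by intro h0; rw [h0, norm_zero] at hυn; exact zero_ne_one hυn
  have h2 : (2 : ℚ_[p]) ≠ 0 := by
    have h := Padic.norm_natCast_eq_one_iff.mpr ((Nat.coprime_primes hp.out Nat.prime_two).mpr hp2)
    rw [Nat.cast_ofNat] at h
    intro h0; rw [h0, norm_zero] at h; exact zero_ne_one h
  have hlog := padicFormalLog_param_eq_inv_u_mul_padicLog W hq0 hq hC hu hr hs ht hυ1 hυne hX hY
  have hL : logUnitParamSq W p q x y = padicLog p υ ^ 2 := by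
    unfold logUnitParamSq
    rw [hlog, ← hscale]
    field_simp
  rw [hL, coshOfSq_padicLog_sq hp2 hυ1', tateSigmaSq_cosh_eq hq hυ0 h2]

/-- **The inputs `hS0`, `hΘ` of `exists_isSplitMultCanonical_of_theta_split` at a split
multiplicative prime `p ≠ 2`, from Silverman's theta difference relation at `q = Dq.q`**:
`S(P) = C²σ_q(u(P))² ≠ 0` on `E₁` and `S(P+Q)S(P−Q) = (x_Q−x_P)² S(P)² S(Q)²` for generic
`P, Q ∈ E(ℚ) ∩ E₁(ℚ_p)`. Composition of `tateSigma_input_of_uniformization` (over `K = ℚ_p`,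
`ι = id`) with the uniformisation data `exists_splitUniformizationData` (`C_SW = u⁻¹`,
shift `−u⁻²r`) and the value identity `tateSigmaSq_coshOfSq_logUnitParamSq_eq`.
[Stein–Wuthrich 2013, §4.2 (pp. 15–16); Silverman ATAEC Prop. V.3.2 (b)(i)]
[cite: SteinWuthrich2013, §4.2 (pp. 15–16)] [cite: SilvermanATAEC1994, Prop. V.3.2 (b) (PDF p. 399)] -/
theorem tateSigma_input_of_thetaRelation [W.IsElliptic] [W.IsGloballyMinimal] (hp2 : p ≠ 2)
    (Dq : TateParameterData W p)
    (hV32 : ∀ u₁ u₂ : ℚ_[p], u₁ ≠ 0 → u₂ ≠ 0 → (∀ n : ℤ, u₁ ≠ Dq.q ^ n) →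
      (∀ n : ℤ, u₂ ≠ Dq.q ^ n) →
      (tateX Dq.q u₁ - tateX Dq.q u₂) * tateTheta Dq.q u₁ ^ 2 * tateTheta Dq.q u₂ ^ 2 =
        -(u₂ * tateTheta Dq.q (u₁ * u₂) * tateTheta Dq.q (u₁ * u₂⁻¹))) :
    (∀ {x y : ℚ} (_ : W.toAffine.Nonsingular x y), 1 < ‖(x : ℚ_[p])‖ →
      uniformisationScaleSq W p Dq.q *
        tateSigmaSq Dq.q (coshOfSq (logUnitParamSq W p Dq.q x y)) ≠ 0) ∧
    (∀ {x₁ y₁ x₂ y₂ x₃ y₃ x₄ y₄ : ℚ} (h₁ : W.toAffine.Nonsingular x₁ y₁)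
      (h₂ : W.toAffine.Nonsingular x₂ y₂) (h₃ : W.toAffine.Nonsingular x₃ y₃)
      (h₄ : W.toAffine.Nonsingular x₄ y₄), 1 < ‖(x₁ : ℚ_[p])‖ → 1 < ‖(x₂ : ℚ_[p])‖ → x₁ ≠ x₂ →
      (.some x₁ y₁ h₁ : W.toAffine.Point) + .some x₂ y₂ h₂ = .some x₃ y₃ h₃ →
      (.some x₁ y₁ h₁ : W.toAffine.Point) - .some x₂ y₂ h₂ = .some x₄ y₄ h₄ →
        (uniformisationScaleSq W p Dq.q *
            tateSigmaSq Dq.q (coshOfSq (logUnitParamSq W p Dq.q x₃ y₃))) *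
            (uniformisationScaleSq W p Dq.q *
              tateSigmaSq Dq.q (coshOfSq (logUnitParamSq W p Dq.q x₄ y₄))) =
          ((x₂ : ℚ_[p]) - x₁) ^ 2 *
            (uniformisationScaleSq W p Dq.q *
              tateSigmaSq Dq.q (coshOfSq (logUnitParamSq W p Dq.q x₁ y₁))) ^ 2 *
            (uniformisationScaleSq W p Dq.q *
              tateSigmaSq Dq.q (coshOfSq (logUnitParamSq W p Dq.q x₂ y₂))) ^ 2) := by
  have hq0 := Dq.q_ne_zero
  have hq := Dq.norm_q_lt_one
  obtain ⟨C, υ, hC, hu, hr, hscale, hυ, hυadd, hυsub⟩ := exists_splitUniformizationData Dq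
  obtain ⟨hs, ht⟩ := norm_s_t_le_one_of_smul_eq_tateCurve hp2 hC hu hr
  have hu0 : (C.u : ℚ_[p]) ≠ 0 := C.u.ne_zero
  refine tateSigma_input_of_uniformization (K := ℚ_[p]) (RingHom.id ℚ_[p]) hq0 hq hV32
    (C := (C.u : ℚ_[p])⁻¹) (-(((C.u : ℚ_[p])⁻¹) ^ 2 * C.r)) hscale (inv_ne_zero hu0) υ
    (fun h hx => ⟨(hυ h hx).1, (hυ h hx).2.2.2.1⟩) (fun h hx => ?_) (fun h hx => ?_) hυadd hυsub
  · -- `X(υ(P)) = u⁻²(x − r) = C² x + (−C² r)`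
    simp only [RingHom.id_apply]
    rw [(hυ h hx).2.2.2.2.1, VariableChange.toX_def, Units.val_inv_eq_inv_val]
    ring
  · obtain ⟨-, hυ1, hυne, -, hX, hY⟩ := hυ h hx
    simp only [RingHom.id_apply]
    exact tateSigmaSq_coshOfSq_logUnitParamSq_eq hp2 hq0 hq hC hu hr hs ht hscale hυ1 hυne hX hY

/-- **Stein–Wuthrich 2013 §4.2 (existence of the canonical `p`-adic height at a split multiplicative
prime `p ≠ 2`) follows from Silverman's theta difference relation on Tate curves over `ℚ_p`**:
if for every odd prime `p`, every `q ∈ ℚ_p` with `0 < |q| < 1` and all `u₁, u₂ ∈ ℚ_p^* ∖ q^ℤ`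
`(X(u₁) − X(u₂)) θ(u₁)² θ(u₂)² = −u₂ θ(u₁u₂) θ(u₁u₂⁻¹)` (ATAEC Prop. V.3.2 (b)(i) with the
normalised `θ` of `TateCurve.tateTheta`), then the named fact `exists_isSplitMultCanonical` holds:
every `(W, p ≠ 2, Dq)` carries a `PAdicHeightData` whose pairing is SW's (4.1) on `E₁(ℚ_p)`.
[Stein–Wuthrich 2013, §4.2 (pp. 15–16); Silverman ATAEC Prop. V.3.2 (b)(i)]
[cite: SteinWuthrich2013, §4.2 (pp. 15–16)] [cite: SilvermanATAEC1994, Prop. V.3.2 (b) (PDF p. 399)] -/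
theorem exists_isSplitMultCanonical_of_thetaRelation
    (hV32 : ∀ (p : ℕ) [Fact p.Prime], p ≠ 2 → ∀ q : ℚ_[p], q ≠ 0 → ‖q‖ < 1 →
      ∀ u₁ u₂ : ℚ_[p], u₁ ≠ 0 → u₂ ≠ 0 → (∀ n : ℤ, u₁ ≠ q ^ n) → (∀ n : ℤ, u₂ ≠ q ^ n) →
        (tateX q u₁ - tateX q u₂) * tateTheta q u₁ ^ 2 * tateTheta q u₂ ^ 2 =
          -(u₂ * tateTheta q (u₁ * u₂) * tateTheta q (u₁ * u₂⁻¹))) :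
    exists_isSplitMultCanonical :=
  exists_isSplitMultCanonical_of_theta_split fun _W _ _ p _ hp2 Dq =>
    tateSigma_input_of_thetaRelation hp2 Dq (hV32 p hp2 Dq.q Dq.q_ne_zero Dq.norm_q_lt_one)

end Literature.NumberTheory.EllipticCurves.SteinWuthrich2013

end
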